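import Mathlib
import Summits.ResolutionOfSingularities.ResolutionOfSingularities.Theorems.HomologicalConductorPersistenceKC3WitnessTransport
import HarnessLib

/-!
# Rung S-2 `PersistenceSurface` (stmt-ResolutionOfSingularities-19970) — the PLATEAU CERTIFICATE:
# a `2 × 2` presentation that is antidiagonal modulo `Φ` cannot sandwich a low power of `z`

Route `ResolutionOfSingularities/HomologicalConductor` (cell decomp-res, hand leafhand-res-homologicalconduct-23 g0).
OURS: AI-written, weaker than expert review; nothing here is a statement of the manuscript under review (Hironaka 2017);
no crux, kill test or summit statement is proved.  SUPPORT level, def-free, fact-free.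

THE MECHANISM (memo `HAND23-PLATEAU-DICHOTOMY.md`, evidence on the item).  Let a stage `B` of the canonical `ca`-tower
have normalised `ca`-blow-up `X'` and let `P ∈ X'` be a rational double point of type `A_n` obtained by contracting a bare
chain of (−2)-curves `C_1, …, C_n` flanked on both sides by Rees curves of `\overline{ca(B)}` along which the cycle of
`\overline{ca(B)}` is a PLATEAU of height `a`.  Then the generic element `x ∈ ca(B)` becomes `unit · z^a` in
`Ô_{X',P} ≅ k'[[u,w,z]]/(uw − z^{n+1})`, the indecomposable MCM module `M_j = (u, z^j) = coker !![u, z^j; z^{n+1−j}, w]`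
reduces modulo `(u, w)` to the antidiagonal presentation `!![0, z^j; z^{n+1−j}, 0]` over `k'[z]/(z^{n+1})`, and
persistence `x ∈ ca(O_{X',P})` would make `x` STABLY ANNIHILATE `M_j ⊗ O_{X',P}`, i.e. (sandwich criterion
`KC3WitnessTransport.stablyAnnihilates_coker_iff_exists_mul_mul_eq'`, [IyengarTakahashi2014, Remark 2.13]) give a matrix
`B` with `D B D = x • D` for a presentation `D` of `M_j` over the stage.  This file proves the ring-agnostic obstruction:

* `not_stablyAnnihilates_coker_of_antidiagonal` — for ANY ring map `Φ : T → R`, any `D : Matrix (Fin 2) (Fin 2) T` with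
  `Φ(D₀₀) = Φ(D₁₁) = 0`, `Φ(D₀₁) = z^j`, and any `x` with `Φ x = c·z^a`, `c` a unit, `a < j`: if `z^{a+j}` is not a multiple
  of `z^{a+j+1}` in `R`, then `x` does NOT stably annihilate `coker D = T² ⧸ D·T²` (reading the `(0,1)` entry of the sandwich
  through `Φ` gives `z^{2j}·β = c·z^{a+j}`);
* `pow_ne_mul_pow_succ_of_map` — the non-divisibility hypothesis descends along ring maps;
* `X_pow_ne_mul_X_pow_succ_mod` — it holds for `z = X` in the truncated polynomial ring `k[X]/(X^N)`, `a + j < N`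
  (the ring `Ô_{X',P}/(u,w)` with `N = n+1`), over any nontrivial commutative ring `k`.

Hence at an `A_n` point the certificate needs only `a < j` and `a + j ≤ n`, i.e. `a < min(j, n+1−j)`; with
`j = ⌈(n+1)/2⌉` this is the memo's inequality `a < ⌈n/2⌉`.  The remaining sockets of a plateau refutation of
`PersistenceSurface` (a stage `B` realising the plateau — suspected: long-chain cusp/elliptic stages —, the dictionary
`Φ` on `T_1 = O_{X',P}`, the lattice/all-levels step `…PersistenceFrobeniusOrderLocal`) are NOT here.

References: S. B. Iyengar, R. Takahashi, IMRN 2016, Remark 2.13 (stable annihilation) [`IyengarTakahashi2014`]; the tree's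
K-C3 transport `…PersistenceKC3WitnessTransport` (same sandwich shape, `8 × 12`).
-/

noncomputable section

-- single-problem summit: the doubled namespace component `ResolutionOfSingularities` is forced
set_option linter.dupNamespace false

open Summit.ResolutionOfSingularities.ResolutionOfSingularities.Theorems.NoZeno.SandwichCluster
open Summit.ResolutionOfSingularities.ResolutionOfSingularities.Theorems.HomologicalConductor.KC3WitnessTransport

universe u v

namespace Summit.ResolutionOfSingularities.ResolutionOfSingularities.Theorems.HomologicalConductor.PersistenceSurfacePlateauCertificate

/-! ## The antidiagonal obstruction -/

/-- **The plateau certificate.**  Let `Φ : T →+* R`, `D : Matrix (Fin 2) (Fin 2) T` with `Φ (D 0 0) = 0`, `Φ (D 1 1) = 0`,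
`Φ (D 0 1) = z ^ j`, and `x : T` with `Φ x = c * z ^ a`, `c` a unit of `R`, `a < j`.  If `z ^ (a + j)` is not of the form
`r * z ^ (a + j + 1)` in `R`, then `x` does not stably annihilate `coker D = (Fin 2 → T) ⧸ range D`.
Proof: a sandwich `D * B * D = x • D` has `(0,1)` entry `Σ D₀ₘ Bₘₗ Dₗ₁`; under `Φ` only `m = 1, l = 0` survives, giving
`z^j · Φ(B₁₀) · z^j = c · z^a · z^j`, so `z^{a+j} = (c⁻¹ Φ(B₁₀) z^{j−a−1}) · z^{a+j+1}`.  At an `A_n` point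
(`R = k'[z]/(z^{n+1})`, `D ↦ !![0, z^j; z^{n+1−j}, 0]` presenting `M_j = (u, z^j)`) this is «`z^a ∉ s̲ann(M_j)` for
`a < min(j, n+1−j)`». [this work; cite: IyengarTakahashi2014, Remark 2.13] -/
theorem not_stablyAnnihilates_coker_of_antidiagonal {T : Type u} [CommRing T] {R : Type v} [CommRing R]
    (Φ : T →+* R) (D : Matrix (Fin 2) (Fin 2) T) (x : T) (z c : R) (hc : IsUnit c) (a j : ℕ) (haj : a < j)
    (hD00 : Φ (D 0 0) = 0) (hD11 : Φ (D 1 1) = 0) (hD01 : Φ (D 0 1) = z ^ j) (hx : Φ x = c * z ^ a)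
    (hz : ∀ r : R, r * z ^ (a + j + 1) ≠ z ^ (a + j)) :
    ¬ StablyAnnihilates T x (ModuleCat.of T ((Fin 2 → T) ⧸ LinearMap.range D.mulVecLin)) := by
  intro h
  obtain ⟨B, hB⟩ := (stablyAnnihilates_coker_iff_exists_mul_mul_eq' D x).mp h
  -- read the `(0,1)` entry through `Φ`
  have h01 := congrArg (fun M : Matrix (Fin 2) (Fin 2) T => Φ (M 0 1)) hB
  simp only [Matrix.mul_apply, Fin.sum_univ_two, Matrix.smul_apply, smul_eq_mul, map_add, map_mul,
    hD00, hD11, hD01, hx, zero_mul, mul_zero, add_zero, zero_add] at h01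
  -- `h01 : z ^ j * Φ (B 1 0) * z ^ j = c * z ^ a * z ^ j`
  obtain ⟨c', hc'⟩ := hc.exists_left_inv
  apply hz (c' * Φ (B 1 0) * z ^ (j - a - 1))
  have hzz : z ^ (j - a - 1) * z ^ (a + j + 1) = z ^ j * z ^ j := by
    rw [← pow_add, ← pow_add]; congr 1; omega
  calc c' * Φ (B 1 0) * z ^ (j - a - 1) * z ^ (a + j + 1)
      = c' * Φ (B 1 0) * (z ^ (j - a - 1) * z ^ (a + j + 1)) := by ring
    _ = c' * (z ^ j * Φ (B 1 0) * z ^ j) := by rw [hzz]; ring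
    _ = c' * (c * z ^ a * z ^ j) := by rw [h01]
    _ = z ^ (a + j) := by rw [← mul_assoc, ← mul_assoc, hc', one_mul, pow_add]

/-- The non-divisibility hypothesis descends along a ring map: if `ψ z ^ m` is not a multiple of `ψ z ^ (m+1)` then
`z ^ m` is not a multiple of `z ^ (m+1)`. [folklore] -/
theorem pow_ne_mul_pow_succ_of_map {R : Type u} [CommRing R] {S : Type v} [CommRing S] (ψ : R →+* S) (z : R)
    (m : ℕ) (h : ∀ s : S, s * ψ z ^ (m + 1) ≠ ψ z ^ m) : ∀ r : R, r * z ^ (m + 1) ≠ z ^ m := by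
  intro r hr
  apply h (ψ r)
  have := congrArg ψ hr
  simpa [map_mul, map_pow] using this

/-- In the truncated polynomial ring `k[X]/(X^N)` over a nontrivial commutative ring `k`, `X^m` is not a multiple of
`X^(m+1)` when `m < N` (compare the coefficients of `X^m`).  With `N = n + 1`, `m = a + j` this discharges the hypothesis
of `not_stablyAnnihilates_coker_of_antidiagonal` at an `A_n` point exactly when `a + j ≤ n`. [folklore] -/
theorem X_pow_ne_mul_X_pow_succ_mod {k : Type u} [CommRing k] [Nontrivial k] (N m : ℕ) (hm : m < N) :
    ∀ r : Polynomial k ⧸ Ideal.span {(Polynomial.X : Polynomial k) ^ N},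
      r * (Ideal.Quotient.mk _ Polynomial.X) ^ (m + 1) ≠ (Ideal.Quotient.mk _ Polynomial.X) ^ m := by
  intro r hr
  obtain ⟨f, rfl⟩ := Ideal.Quotient.mk_surjective r
  rw [← map_pow, ← map_pow, ← map_mul, Ideal.Quotient.eq, Ideal.mem_span_singleton] at hr
  obtain ⟨g, hg⟩ := hr
  -- compare coefficients of `X ^ m`
  have h1 : ¬ m + 1 ≤ m := by omega
  have h2 : ¬ N ≤ m := by omega
  have hcoef := congrArg (fun p : Polynomial k => p.coeff m) hg
  simp [Polynomial.coeff_sub, Polynomial.coeff_mul_X_pow', Polynomial.coeff_X_pow_mul', h1, h2,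
    Polynomial.coeff_X_pow] at hcoef

/-- **The plateau certificate at an `A_n` point, packaged.**  `Φ : T →+* k[X]/(X^(n+1))` (the stage read modulo the two
branch equations `u, w` in `Ô_{X',P}`), `D` a `2 × 2` matrix over the stage with `Φ(D) ` antidiagonal with `(0,1)` entry
`X^j`, `Φ x = c X^a` with `c` a unit, and `a < j`, `a + j ≤ n`: then `x` does not stably annihilate `coker D`.
[this work; cite: IyengarTakahashi2014, Remark 2.13] -/
theorem not_stablyAnnihilates_coker_of_antidiagonal_truncated {T : Type u} [CommRing T] {k : Type v} [CommRing k]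
    [Nontrivial k] (n a j : ℕ) (haj : a < j) (hajn : a + j ≤ n)
    (Φ : T →+* Polynomial k ⧸ Ideal.span {(Polynomial.X : Polynomial k) ^ (n + 1)})
    (D : Matrix (Fin 2) (Fin 2) T) (x : T) (c : Polynomial k ⧸ Ideal.span {(Polynomial.X : Polynomial k) ^ (n + 1)})
    (hc : IsUnit c) (hD00 : Φ (D 0 0) = 0) (hD11 : Φ (D 1 1) = 0)
    (hD01 : Φ (D 0 1) = (Ideal.Quotient.mk _ Polynomial.X) ^ j)
    (hx : Φ x = c * (Ideal.Quotient.mk _ Polynomial.X) ^ a) :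
    ¬ StablyAnnihilates T x (ModuleCat.of T ((Fin 2 → T) ⧸ LinearMap.range D.mulVecLin)) :=
  not_stablyAnnihilates_coker_of_antidiagonal Φ D x _ c hc a j haj hD00 hD11 hD01 hx
    (X_pow_ne_mul_X_pow_succ_mod (n + 1) (a + j) (by omega))

/-! ## The model case: `z^a` does not stably annihilate `M_j = coker !![u, z^j; z^{n+1-j}, w]` over `A_n` -/

section ModelAn

open MvPolynomial

variable (k : Type u) [CommRing k] (n : ℕ)

/-- The `A_n` coordinate ring `Λ_n = k[X₀,X₁,X₂]/(X₀X₁ − X₂^{n+1})` (local notation only). -/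
local notation3 "Λ_[" k ", " n "]" =>
  MvPolynomial (Fin 3) k ⧸ Ideal.span {(X 0 * X 1 - X 2 ^ (n + 1) : MvPolynomial (Fin 3) k)}
/-- The quotient map `k[X₀,X₁,X₂] → Λ_n` (local notation only). -/
local notation3 "π_[" k ", " n "]" =>
  Ideal.Quotient.mk (Ideal.span {(X 0 * X 1 - X 2 ^ (n + 1) : MvPolynomial (Fin 3) k)})

/-- **The `A_n` certificate.**  Over the `A_n` coordinate ring `Λ_n = k[u,w,z]/(uw − z^{n+1})`
(`u = X 0`, `w = X 1`, `z = X 2`; any nontrivial commutative `k`, any characteristic), the MCM module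
`M_j = coker !![u, z^j; z^{n+1−j}, w]` (the matrix-factorisation presentation of the ideal `(u, z^j)`) is NOT stably
annihilated by `z^a` when `a < j` and `a + j ≤ n`, i.e. `a < min(j, n+1−j)`: read the presentation modulo `(u, w)` in
`k[X]/(X^{n+1})` and apply `not_stablyAnnihilates_coker_of_antidiagonal_truncated`.  (So `z^a ∉ s̲ann(M_j)` for
`a < min(j, n+1−j)`; with `j = ⌈(n+1)/2⌉`: for all `a < ⌈n/2⌉` — the sharp half of `ca(A_n) = (u, w, z^{⌈n/2⌉})` used by
the plateau criterion.) [this work; cite: IyengarTakahashi2014, Remark 2.13] -/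
theorem not_stablyAnnihilates_An_syzygy [Nontrivial k] (a j : ℕ) (haj : a < j) (hajn : a + j ≤ n) :
    ¬ StablyAnnihilates Λ_[k, n] (π_[k, n] (X 2) ^ a)
      (ModuleCat.of Λ_[k, n] ((Fin 2 → Λ_[k, n]) ⧸ LinearMap.range
        (Matrix.mulVecLin (!![π_[k, n] (X 0), π_[k, n] (X 2) ^ j; π_[k, n] (X 2) ^ (n + 1 - j), π_[k, n] (X 1)] :
          Matrix (Fin 2) (Fin 2) Λ_[k, n])))) := by
  -- the reduction map `Φ : Λ_n → k[X]/(X^{n+1})`, `u, w ↦ 0`, `z ↦ X`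
  set I : Ideal (MvPolynomial (Fin 3) k) := Ideal.span {(X 0 * X 1 - X 2 ^ (n + 1) : MvPolynomial (Fin 3) k)}
    with hI
  set J : Ideal (Polynomial k) := Ideal.span {(Polynomial.X : Polynomial k) ^ (n + 1)} with hJ
  let ψ : MvPolynomial (Fin 3) k →+* Polynomial k ⧸ J :=
    (Ideal.Quotient.mk J).comp (MvPolynomial.aeval ![(0 : Polynomial k), 0, Polynomial.X]).toRingHom
  have hψ0 : ψ (X 0) = 0 := by simp [ψ]
  have hψ1 : ψ (X 1) = 0 := by simp [ψ]
  have hψ2 : ψ (X 2) = Ideal.Quotient.mk J Polynomial.X := by simp [ψ]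
  have hψf : ψ (X 0 * X 1 - X 2 ^ (n + 1)) = 0 := by
    rw [map_sub, map_mul, map_pow, hψ0, hψ2, zero_mul, zero_sub, neg_eq_zero, ← map_pow,
      Ideal.Quotient.eq_zero_iff_mem, hJ]
    exact Ideal.mem_span_singleton_self _
  have hIψ : ∀ p ∈ I, ψ p = 0 := by
    intro p hp
    rw [hI, Ideal.mem_span_singleton] at hp
    obtain ⟨q, rfl⟩ := hp
    rw [map_mul, hψf, zero_mul]
  let Φ : Λ_[k, n] →+* Polynomial k ⧸ J := Ideal.Quotient.lift I ψ hIψ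
  have hΦ : ∀ p, Φ (Ideal.Quotient.mk I p) = ψ p := fun p => Ideal.Quotient.lift_mk I ψ hIψ
  refine not_stablyAnnihilates_coker_of_antidiagonal_truncated n a j haj hajn Φ _ _ 1 isUnit_one ?_ ?_ ?_ ?_
  · simp [hΦ, hψ0]
  · simp [hΦ, hψ1]
  · simp only [Matrix.of_apply, Matrix.cons_val', Matrix.cons_val_zero, Matrix.cons_val_one,
      Matrix.cons_val_fin_one, map_pow, hΦ, hψ2]
    rfl
  · rw [map_pow, hΦ, hψ2, one_mul]

/-- **The matrix factorisation of `A_n`.**  `φ_j = !![u, z^j; z^{n+1−j}, w]` and `ψ_j = !![w, −z^j; −z^{n+1−j}, u]`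
satisfy `φ_j ψ_j = ψ_j φ_j = (uw − z^{n+1})·1` over ANY commutative ring (`j ≤ n + 1`); over `Λ_n` both products
vanish, so `coker φ_j = M_j` and `coker ψ_j = M_{n+1−j}` are syzygies of each other (2-periodicity). [folklore;
cite: IyengarTakahashi2014, Remark 2.13] -/
theorem An_isMatrixFactorization {A : Type u} [CommRing A] (u w z : A) (j : ℕ) (hj : j ≤ n + 1) :
    !![u, z ^ j; z ^ (n + 1 - j), w] * !![w, -z ^ j; -z ^ (n + 1 - j), u] = (u * w - z ^ (n + 1)) • 1 ∧
    !![w, -z ^ j; -z ^ (n + 1 - j), u] * !![u, z ^ j; z ^ (n + 1 - j), w] = (u * w - z ^ (n + 1)) • 1 := by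
  have hpow : z ^ j * z ^ (n + 1 - j) = z ^ (n + 1) := by rw [← pow_add]; congr 1; omega
  generalize n + 1 - j = m at hpow ⊢
  generalize n + 1 = N at hpow ⊢
  constructor <;>
  · ext i l; fin_cases i <;> fin_cases l <;>
      simp [Matrix.mul_apply, Fin.sum_univ_two] <;>
      first | ring1 | (linear_combination hpow) | (linear_combination -hpow)

/-- **The easy half: `u, w, z^j, z^{n+1−j}` DO stably annihilate `M_j` over `Λ_n`**, by the explicit sandwiches
`φ_j E₀₀ φ_j = u φ_j`, `φ_j E₁₁ φ_j = w φ_j`, `φ_j E₁₀ φ_j = z^j φ_j`, `φ_j E₀₁ φ_j = z^{n+1−j} φ_j` (each uses `uw = z^{n+1}`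
once).  With `not_stablyAnnihilates_An_syzygy`: among powers of `z`, `z^m ∈ s̲ann(M_j) ↔ m ≥ min(j, n+1−j)`, and
intersecting over `j` leaves `{u, w} ∪ {z^m : m ≥ ⌈n/2⌉}` — the content of `ca(A_n) = (u, w, z^{⌈n/2⌉})`.
[this work; cite: IyengarTakahashi2014, Remark 2.13] -/
theorem stablyAnnihilates_An_syzygy (j : ℕ) (hj : j ≤ n + 1) (x : Λ_[k, n])
    (hx : x = π_[k, n] (X 0) ∨ x = π_[k, n] (X 1) ∨ x = π_[k, n] (X 2) ^ j ∨ x = π_[k, n] (X 2) ^ (n + 1 - j)) :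
    StablyAnnihilates Λ_[k, n] x
      (ModuleCat.of Λ_[k, n] ((Fin 2 → Λ_[k, n]) ⧸ LinearMap.range
        (Matrix.mulVecLin (!![π_[k, n] (X 0), π_[k, n] (X 2) ^ j; π_[k, n] (X 2) ^ (n + 1 - j), π_[k, n] (X 1)] :
          Matrix (Fin 2) (Fin 2) Λ_[k, n])))) := by
  rw [stablyAnnihilates_coker_iff_exists_mul_mul_eq']
  -- the relation `u w = z^{n+1}` in `Λ_n`
  have hrel : π_[k, n] (X 0) * π_[k, n] (X 1) = π_[k, n] (X 2) ^ (n + 1) := by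
    rw [← map_mul, ← map_pow, Ideal.Quotient.eq, Ideal.mem_span_singleton]
  have hpow : π_[k, n] (X 2) ^ j * π_[k, n] (X 2) ^ (n + 1 - j) = π_[k, n] (X 2) ^ (n + 1) := by
    rw [← pow_add]; congr 1; omega
  generalize π_[k, n] (X 0) = u, π_[k, n] (X 1) = w, π_[k, n] (X 2) = z at hrel hpow hx ⊢
  generalize n + 1 - j = m at hpow hx ⊢
  rcases hx with rfl | rfl | rfl | rfl
  · refine ⟨!![1, 0; 0, 0], ?_⟩
    ext i l; fin_cases i <;> fin_cases l <;> simp [Matrix.mul_apply, Fin.sum_univ_two] <;>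
      first | ring1 | (linear_combination hrel - hpow) | (linear_combination hpow - hrel)
  · refine ⟨!![0, 0; 0, 1], ?_⟩
    ext i l; fin_cases i <;> fin_cases l <;> simp [Matrix.mul_apply, Fin.sum_univ_two] <;>
      first | ring1 | (linear_combination hrel - hpow) | (linear_combination hpow - hrel)
  · refine ⟨!![0, 0; 1, 0], ?_⟩
    ext i l; fin_cases i <;> fin_cases l <;> simp [Matrix.mul_apply, Fin.sum_univ_two] <;>
      first | ring1 | (linear_combination hrel - hpow)
  · refine ⟨!![0, 1; 0, 0], ?_⟩
    ext i l; fin_cases i <;> fin_cases l <;> simp [Matrix.mul_apply, Fin.sum_univ_two] <;>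
      first | ring1 | (linear_combination hrel - hpow)

end ModelAn

end Summit.ResolutionOfSingularities.ResolutionOfSingularities.Theorems.HomologicalConductor.PersistenceSurfacePlateauCertificate

end
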